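import Mathlib
import HarnessLib
import Literature.NumberTheory.GelbartRogawski1991.WeilRepresentationsAPackets

/-!
# Gelbart–Rogawski 1991, §5.2 «θ-series liftings» — the posited DATUM of the theta-series-lifting vocabulary
# (unitary groups `H = U(Φ′)` over `F`, the spaces `Θ(ψ, s, τ)`, «`π` is a theta-series lifting of `τ`», the
# `(U(1), U(3))` objects `ω¹(γ, ψ)`, `θ¹(γ, ψ, χ)`, occurrence, the residual `π(ξ)`), over the ★ dictionary
# `GR91Spectrum` — DATUM ONLY (types ∕ functions ∕ one definition with a body; nothing asserted, nothing proved)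

S. Gelbart, J. Rogawski, *L-functions and Fourier–Jacobi coefficients for the unitary group `U(3)`*, Invent. Math.
**105** (1991) 445–472 [GelbartRogawski1991], §5.2 pp. 466–468 (read on the GDZ Göttingen page IMAGES
`img_p466.jpg`–`img_p468.jpg`, PPN356556735_0105, canvas = printed page + 6; «p. N Lk» = printed page, approximate
body line).  Carpet-typing squad TG (cell hodgecm-mathlib), seat TG-t03 = OWNER of this file by the squad lead's
RULING 2 (D); it is IMPORTED by the section files `Sec5.lean` (Prop. 5.2.1, Cor. 5.2.2, Remarks p. 468; seat TG-t03)
and `Sec6.lean` (Thm. 6.1.1 (2), Prop. 6.2.1, Lemma 6.2.2: theta-series liftings from unitary groups `U(Φ′)` in two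
variables; seat TG-t04), which state the printed results as `Prop`-valued relations over it.  Namespace
`Literature.NumberTheory.GelbartRogawski1991.Sec5Defs`.

DISCIPLINE (★ `GR91Spectrum`, `WeilRepresentationsAPackets.lean`): the global dictionary `X : GR91Spectrum` (quasi-split
`G = U(3)` of the quadratic extension `E/F` of number fields, §1.1 p. 449; `Rep`, `Char1`, `OmegaHecke`, `AddChar`,
`NormClassEq`, `weil γ ψ χ = ω(γ, ψ, χ)`, `packetA`) is IMPORTED AND REUSED, never re-posited.  This file imports no
other squad file: the places `v` of `F` and the ★ LOCAL dictionaries `GR91LocalPacket` at each `v` are carried by the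
squad's `L`-function ∕ endoscopy datum `EndoscopicLData` (`Sec1Defs.lean`, seat TG-t05), and LOCAL occurrence «`χ_v`
occurs in `ω¹(γ_v, ψ_v)`» is DEFINED in `Sec5.lean` through it as ★ `GR91LocalPacket.OccursU1` at `v` — so only the
GLOBAL `(U(1), U(3))` objects are posited here.  **No theorem, no proof, no `sorry`,
no axiom, no instance, no notation; no `Prop`-valued field asserts anything printed as a result** — the one
`Prop`-level declaration, `IsThetaLift`, is the printed DEFINITION with its body.

## The printed text this datum carries (pp. 466–468)
* p. 466 foot – p. 467 L4: «5.2 *θ-series liftings.* We recall the notion of theta-series lifting. Suppose that `G` and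
  `H` are unitary groups in `n` and `m` variables, respectively. Then there exists an embedding `s` of `G × H` in the
  metaplectic group on `2nm` variables (the obvious analogue of Prop. 3.1.1 holds for `G × H`) and we may consider the
  restrictions to `G × H` of metaplectic theta series relative to `s` and `ψ`. Let `ϑ(g, h)` be such a theta function.
  Let `π` and `τ` be irreducible cuspidal representations of `G` and `H`, respectively. We say that `π` is a
  theta-series lifting of `τ` if `V_τ` [sic; `V_π`] is contained in the space `Θ(ψ, s, τ)` of functions of the form
  `g ⟶ ∫_{H(F)\H(𝔸)} ϑ(g, h) f(h) dh` for some `ϑ(g, h)` and some `f ∈ V_τ`. It is known that if `Θ(ψ, s, τ)` is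
  cuspidal, then it is irreducible (cf. [Ra]).»  Here `G` is FIXED = the quasi-split `U(3)` of `X` (`n = 3`) and `H`
  ranges over the unitary groups `U(Φ′)` over `F` (§6 uses `m = 2`, `Φ′` any Hermitian form in two variables, and
  `m = 1`); ★ Prop. 3.1.1 = `Literature.NumberTheory.GelbartRogawski1991.SplittingDatum.CompatibleSplitting`.
* p. 467 L6–11: «We have seen that the choice of data `(γ, ψ)` simultaneously fixes embeddings of `U(1)` and `U(3)` in
  their corresponding metaplectic groups. We denote the corresponding oscillator representations by `ω¹(γ, ψ)` and
  `ω³(γ, ψ)`. For any automorphic character `χ` of `U(1)`, let `θ¹(γ, ψ, χ)` and `θ³(γ, ψ, χ)` be the space of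
  associated theta functions on `U(1)` and `U(3)`, respectively.»  (`θ³(γ, ψ, χ)` realises `ω(γ, ψ, χ) = X.weil γ ψ χ`,
  §3.4 pp. 459–460.)
* p. 467 L33–37: «In the context of `(U(1), U(1))`, the Howe lift of `χ` relative to `ω¹(γ, ψ)` is defined only if `χ`
  occurs in `ω¹(γ, ψ)` … a Howe lift is defined globally if and only if it is defined locally everywhere» (GLOBAL
  occurrence; the local occurrence of p. 467 (3) ∕ p. 468 Remarks (1) is ★ `GR91LocalPacket.OccursU1` at each place,
  reached through `EndoscopicLData.loc` in `Sec5.lean`).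
* Cor. 5.2.2 p. 467: «the corresponding theta lift `θ¹(γ, ψ, χ)` is non-zero», «unique modulo norms»; Prop. 5.2.1 (2):
  «`θ¹(γ, ψ, χ(γ¹)⁻¹) = {0}`».
* p. 447 L4–6 ∕ p. 468 L17: `ψ^δ(x) = ψ(δx)`, `δ ∈ F*`; classes modulo `N_{E/F}(E*)` (Cor. 5.2.2; Thm. 6.1.1 (2) «the unique
  class in `F*/N_{E/F}(E*)` such that `ϱ₁` occurs in `ω¹(γ, ψ_δ)`»).
* p. 468 Remarks (2): «Let `ξ` be a Hecke character of `E` whose restriction to `F` is `ω_{E/F}`. If `E(g, s, ξ)` has a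
  non-trivial residue at `s = 1/2`, than [sic] the residue generates a representation `π(ξ)` …» (`E(g, s, ξ)` the
  Eisenstein series of §4.1 p. 462 — squad file `Sec4.lean`, seat TG-t02).

## References
* [GelbartRogawski1991] Invent. Math. 105 (1991): §5.2 pp. 466–468; §3.4 pp. 459–460; Introduction p. 447.
* [Rallis1984] S. Rallis, *On the Howe duality conjecture*, Compositio Math. 51 (1984) 333–399 (= `[Ra]`).
-/

noncomputable section

namespace Literature.NumberTheory.GelbartRogawski1991.Sec5Defs

universe u

/-- **`ThetaLiftData X` — the posited DATUM of §5.2 «θ-series liftings»** over the ★ dictionary `X : GR91Spectrum` (`G` =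
the quasi-split `U(3)` of `E/F`).  Carriers and primitives ONLY; nothing is asserted.  Intended meaning, in the printed words (pp. 466–468):
* `UGrp` — the unitary groups `H = U(Φ′)` over `F` (relative to `E/F`) in `m = dim H` variables («Suppose that `G` and
  `H` are unitary groups in `n` and `m` variables», p. 466; here `G = U(3)` is fixed);
* `CuspRep H` — the irreducible cuspidal (automorphic) representations `τ` of `H(𝔸)` (p. 466 last lines);
* `ThetaDatum H` — the data `(s, ψ)`: «an embedding `s` of `G × H` in the metaplectic group on `2nm` variables» and a
  non-trivial character `ψ` of `F\𝔸` («metaplectic theta series relative to `s` and `ψ`», pp. 466–467); `addCharOf` reads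
  off `ψ`;
* `FormG` — automorphic forms on `G(𝔸)`; `V π = V_π ⊆ FormG` — «`V_π` will denote the space on which `π` acts» (§1.2
  p. 450), for cuspidal `π` its (unique, by multiplicity one for `G` [R], p. 466) realisation in cusp forms;
* `Theta H d τ = Θ(ψ, s, τ)` — «the space `Θ(ψ, s, τ)` of functions of the form `g ⟶ ∫_{H(F)\H(𝔸)} ϑ(g, h) f(h) dh` for
  some `ϑ(g, h)` and some `f ∈ V_τ`» (p. 467 L1–4);
* `ThetaSpaceCuspidal H d τ`, `ThetaSpaceIrreducible H d τ` — «`Θ(ψ, s, τ)` is cuspidal», «it is irreducible» (p. 467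
  L5–6);
* `OccursU1 γ ψ χ` — «`χ` occurs in `ω¹(γ, ψ)`» globally (p. 467 L33–36), `ω¹(γ, ψ)` = the oscillator representation of
  `U(1)` for the embedding fixed by `(γ, ψ)` (p. 467 L6–9: «the choice of data `(γ, ψ)` simultaneously fixes embeddings of
  `U(1)` and `U(3)` in their corresponding metaplectic groups. We denote the corresponding oscillator representations by
  `ω¹(γ, ψ)` and `ω³(γ, ψ)`»); the LOCAL «`χ_v` occurs in `ω¹(γ_v, ψ_v)`» is ★ `GR91LocalPacket.OccursU1` at `v` (not a
  field here);
* `ThetaU1Nonzero γ ψ χ` — «the corresponding theta lift `θ¹(γ, ψ, χ)` is non-zero» (Cor. 5.2.2), `θ¹(γ, ψ, χ)` = «the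
  space of associated theta functions on `U(1)`» for `χ` (p. 467 L9–11);
* `NormClass`, `twistAdd c ψ = ψ^δ` — the classes `F*/N_{E/F}(E*)` and `ψ ↦ ψ^δ`, `ψ^δ(x) = ψ(δx)` (p. 447 L4–6), for a
  representative `δ` of the class `c` (every `(γ, ψ^δ)`-object depends on `δ` only modulo `N_{E/F}(E*)`, §3.2 Remark
  (3) p. 458 = ★ `GR91LocalPacket.weil_normClass_const` locally; in the intended model `X.NormClassEq ψ ψ′ ↔ ∃ c, ψ′ =
  twistAdd c ψ`);
* `EisResidueNontrivial ξ`, `eisResidueRep ξ = π(ξ)` — «If `E(g, s, ξ)` has a non-trivial residue at `s = 1/2`, than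
  [sic] the residue generates a representation `π(ξ)`» (p. 468 Remarks (2); `ξ ∈ X.OmegaHecke`, i.e. `ξ|_F = ω_{E/F}`);
  `eisResidueRep ξ` is meaningful only under `EisResidueNontrivial ξ`.
PARALLELS (same notions elsewhere in the squad, for the merge): `Sec4.lean` (TG-t02) carries `E(g, s, ξ)` itself;
`Sec6.lean` (TG-t04) adds the §6-only sockets (`InClassDiag`, Howe lifts at `v`, …) over THIS datum.
[cite: GelbartRogawski1991, §5.2 (pp. 466–468); §3.4 (pp. 459–460); Introduction (p. 447)] -/
structure ThetaLiftData (X : GR91Spectrum.{u}) : Type (u + 1) where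
  /-- the unitary groups `H = U(Φ′)` over `F` [§5.2 p. 466] -/
  UGrp : Type u
  /-- `m`, the number of variables of `H` [p. 466] -/
  dim : UGrp → ℕ
  /-- irreducible cuspidal representations `τ` of `H(𝔸)` [p. 466] -/
  CuspRep : UGrp → Type u
  /-- the data `(s, ψ)`: an embedding `s` of `G × H` in the metaplectic group on `2·3·m` variables and `ψ` [pp. 466–467] -/
  ThetaDatum : UGrp → Type u
  /-- the additive character `ψ` of the datum `(s, ψ)` [p. 466] -/
  addCharOf : (H : UGrp) → ThetaDatum H → X.AddChar
  /-- automorphic forms on `G(𝔸)` [§1.2 p. 450] -/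
  FormG : Type u
  /-- `V_π`, the space of (cusp) forms of `π` [§1.2 p. 450; p. 467 L1] -/
  V : X.Rep → Set FormG
  /-- `Θ(ψ, s, τ)`, the functions `g ⟶ ∫_{H(F)\H(𝔸)} ϑ(g, h) f(h) dh` [p. 467 L1–4] -/
  Theta : (H : UGrp) → ThetaDatum H → CuspRep H → Set FormG
  /-- «`Θ(ψ, s, τ)` is cuspidal» [p. 467 L5] -/
  ThetaSpaceCuspidal : (H : UGrp) → ThetaDatum H → CuspRep H → Prop
  /-- «[`Θ(ψ, s, τ)`] is irreducible» [p. 467 L5–6] -/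
  ThetaSpaceIrreducible : (H : UGrp) → ThetaDatum H → CuspRep H → Prop
  /-- «`χ` occurs in `ω¹(γ, ψ)`» (globally) [p. 467 L33–36] -/
  OccursU1 : X.OmegaHecke → X.AddChar → X.Char1 → Prop
  /-- «the theta lift `θ¹(γ, ψ, χ)` is non-zero» [Cor. 5.2.2 p. 467; Prop. 5.2.1 (2)] -/
  ThetaU1Nonzero : X.OmegaHecke → X.AddChar → X.Char1 → Prop
  /-- the classes `F*/N_{E/F}(E*)` [Cor. 5.2.2 p. 467; Thm. 6.1.1 (2) p. 468] -/
  NormClass : Type u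
  /-- `ψ ↦ ψ^δ`, `ψ^δ(x) = ψ(δx)`, for a representative `δ` of the class [p. 447 L4–6; p. 468 L17] -/
  twistAdd : NormClass → X.AddChar → X.AddChar
  /-- «`E(g, s, ξ)` has a non-trivial residue at `s = 1/2`» [p. 468 Remarks (2); §4.1 p. 462] -/
  EisResidueNontrivial : X.OmegaHecke → Prop
  /-- `π(ξ)`, the representation generated by the residue of `E(g, s, ξ)` at `s = 1/2` [p. 468 Remarks (2)] -/
  eisResidueRep : X.OmegaHecke → X.Rep

/-- **DEFINITION (theta-series lifting)** [§5.2 p. 466 last line – p. 467 L4]: «We say that `π` is a theta-series lifting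
of `τ` if `V_τ` [sic; read `V_π` — `V_τ ⊆ Θ(ψ, s, τ)` would be a condition on forms on `H`, while `Θ(ψ, s, τ)` consists
of functions on `G`; corrected because the printed inclusion is ill-typed] is contained in the space `Θ(ψ, s, τ)` of
functions of the form `g ⟶ ∫_{H(F)\H(𝔸)} ϑ(g, h) f(h) dh` for some `ϑ(g, h)` and some `f ∈ V_τ`.»  Relative to the
datum `d = (s, ψ)`; `π` a cuspidal representation of `G = U(3)`, `τ` of `H = U(Φ′)`.
[cite: GelbartRogawski1991, §5.2 Definition of theta-series lifting (pp. 466–467)] -/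
def IsThetaLift {X : GR91Spectrum.{u}} (T : ThetaLiftData X) (H : T.UGrp) (τ : T.CuspRep H)
    (d : T.ThetaDatum H) (π : X.Rep) : Prop :=
  T.V π ⊆ T.Theta H d τ

end Literature.NumberTheory.GelbartRogawski1991.Sec5Defs

end
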